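import Literature.RingTheory.CohomologyAnnihilator.NoetherDifferentAnnihilator
import Literature.RingTheory.CohomologyAnnihilator.RegularRing
import HarnessLib

/-!
# A noether normalisation with non-zero noether different gives `ca^{d+1} ≠ 0` (Iyengar–Takahashi, Thm. 3.6)

Topic: `Literature/RingTheory/CohomologyAnnihilator`. [IyengarTakahashi2014, Theorem 3.6]: "If
`Λ` admits a separable noether normalization, then for `d = dim Z(Λ)` the ideal `ca^{d+1}(Λ)`
of `Z(Λ)` is non-zero." We PROVE the commutative case in the following form, in which the
separability of the noether normalisation enters only through its consequence
"`𝔑(B/P)` contains a non-zero element" (Lemma 3.5; for the field case see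
`NoetherDifferentUnramified.lean`):

* `cohomologyAnnihilatorOfDegree_ne_bot_of_noetherDifferent_ne_bot` — let `B` be a domain which
  is module-finite over a REGULAR domain `P` of Krull dimension `≤ d` along an injective
  structure map, and suppose `𝔑(B/P) ≠ 0`. Then `ca^{d+1}(B) ≠ 0`.
  Proof as printed: `I = ann_P Ext¹_P(B, Ω_P B)` is non-zero because `P_{(0)}` is a field, so
  `Ext¹` dies generically and `B` is finitely generated (`annihilator_ext_not_le_of_isRegularLocalRing`
  at the prime `(0)`); `I ⊆ I' = ann_P Ext^{≥1}_P(B, mod P)` (Lemma 2.14); `gldim P ≤ d`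
  (`RegularRing.lean`); and Proposition 3.4 gives `𝔑(B/P) · I'ᵈ ⊆ ca^{d+1}(B)`, whose left side
  contains the non-zero product of a non-zero element of `𝔑(B/P)` and `aᵈ`, `0 ≠ a ∈ I`.
* `cohomologyAnnihilatorOfDegree_ne_bot_of_mvPolynomial` — the case `P = k[x₁, …, x_d]`
  (Hilbert's syzygy theorem, `RegularRing.lean`): an affine domain `B`, finite over a polynomial
  subalgebra in `d` variables with `𝔑 ≠ 0`, has `ca^{d+1}(B) ≠ 0`.

What is NOT here: the existence of a separable noether normalisation of an affine domain over a
perfect field (Nagata, Thm. 39.11) and Lemma 3.5 (`𝔑(B/P) ≠ 0` from generic separability: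
localisation of the noether different), i.e. the remaining inputs of Theorem 3.6 as used in the
proof of [IyengarTakahashi2014, Theorem 5.4].

## References

* S. B. Iyengar, R. Takahashi, *Annihilation of cohomology and strong generation of module
  categories*, IMRN 2016; arXiv:1404.1476 — Theorem 3.6, Proposition 3.4, Lemma 2.14.
  [`IyengarTakahashi2014`]
-/

noncomputable section

open CategoryTheory CategoryTheory.Abelian

universe u

namespace Literature.RingTheory.CohomologyAnnihilator

/-- **Theorem 3.6** (commutative case, separability through `𝔑 ≠ 0`): a domain `B`,
module-finite over a regular domain `P` of Krull dimension `≤ d` with `P → B` injective and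
`𝔑(B/P) ≠ 0`, has `ca^{d+1}(B) ≠ 0`. [cite: IyengarTakahashi2014, Thm. 3.6] -/
theorem cohomologyAnnihilatorOfDegree_ne_bot_of_noetherDifferent_ne_bot {P : Type u} [CommRing P]
    [IsDomain P] [IsRegularRing P] {B : Type u} [CommRing B] [IsDomain B] [Algebra P B]
    [Module.Finite P B] (hinj : Function.Injective (algebraMap P B)) {d : ℕ}
    (hdim : ringKrullDim P ≤ d) (hN : noetherDifferent P B ≠ ⊥) :
    cohomologyAnnihilatorOfDegree B (d + 1) ≠ ⊥ := by
  -- `gldim P ≤ d`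
  have hvan := cohomologyAnnihilatorOfDegree_eq_top_of_isRegularRing P hdim
  -- `I = ann_P Ext¹_P(B, Ω_P B) ≠ 0`, and `I ⊆ I'`
  let G : ModuleCat.{u} P := (restrictScalarsFunctor P B).obj (ModuleCat.of B B)
  haveI : Module.Finite P G := finite_restrictScalars (ModuleCat.of B B)
  obtain ⟨H, hHfin, hH⟩ := exists_isSyzygy G 1
  haveI := hHfin
  have hI : Module.annihilator P (Ext.{u} G H 1) ≤ extAnnihilatorFrom G 1 :=
    annihilator_ext_le_extAnnihilatorFrom (d := 0) hH
  have hne : ¬ Module.annihilator P (Ext.{u} G H 1) ≤ (⊥ : Ideal P) :=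
    annihilator_ext_not_le_of_isRegularLocalRing G H ⊥
      (IsRegularRing.isRegularLocalRing_localization ⊥) (d := 0)
      (by rw [Ideal.height_bot]; exact zero_le) le_rfl
  obtain ⟨a, haI, ha0⟩ := SetLike.not_le_iff_exists.mp hne
  have ha0' : a ≠ 0 := fun h => ha0 (h ▸ Ideal.zero_mem _)
  -- a non-zero element of `𝔑(B/P) · I'ᵈ ⊆ ca^{d+1}(B)`
  obtain ⟨x, hx, hx0⟩ := Submodule.exists_mem_ne_zero_of_ne_bot hN
  have hz := noetherDifferent_mul_mem_cohomologyAnnihilatorOfDegree hvan hx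
    (Ideal.pow_mem_pow (hI haI) d)
  have hz' : x * algebraMap P B (a ^ d) ≠ 0 :=
    mul_ne_zero hx0 ((map_ne_zero_iff _ hinj).mpr (pow_ne_zero d ha0'))
  intro hbot
  rw [hbot, Ideal.mem_bot] at hz
  exact hz' hz

/-- **Theorem 3.6** for a polynomial noether normalisation: an affine domain `B` over a field
`k`, finite over `k[x₁, …, x_d] → B` (injective) with `𝔑(B / k[x₁, …, x_d]) ≠ 0`, has
`ca^{d+1}(B) ≠ 0` (`gldim k[x₁, …, x_d] = d`, Hilbert). [cite: IyengarTakahashi2014, Thm. 3.6] -/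
theorem cohomologyAnnihilatorOfDegree_ne_bot_of_mvPolynomial (k : Type u) [Field k] (d : ℕ)
    {B : Type u} [CommRing B] [IsDomain B] [Algebra (MvPolynomial (Fin d) k) B]
    [Module.Finite (MvPolynomial (Fin d) k) B]
    (hinj : Function.Injective (algebraMap (MvPolynomial (Fin d) k) B))
    (hN : noetherDifferent (MvPolynomial (Fin d) k) B ≠ ⊥) :
    cohomologyAnnihilatorOfDegree B (d + 1) ≠ ⊥ := by
  refine cohomologyAnnihilatorOfDegree_ne_bot_of_noetherDifferent_ne_bot hinj (le_of_eq ?_) hN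
  rw [MvPolynomial.ringKrullDim_of_isNoetherianRing, ringKrullDim_eq_zero_of_field, zero_add,
    Nat.card_eq_fintype_card, Fintype.card_fin]

end Literature.RingTheory.CohomologyAnnihilator

end
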